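import Summits.BirchSwinnertonDyer.BirchSwinnertonDyer.Theorems.BiquadraticEisensteinDescentSymbolicMonskyDefs
import Mathlib.LinearAlgebra.Span.Defs
import HarnessLib

set_option linter.dupNamespace false -- `Summit.BirchSwinnertonDyer.BirchSwinnertonDyer.Theorems.…` (summit = sub)
set_option autoImplicit false

/-!
# Route `BiquadraticEisensteinDescent` — DEFINITIONS (D-0017 `Theorems/<RouteSlug><Topic>Defs.lean`, reviewed): the EVEN virtual kernel and the
# EVEN pencil of a symbol datum, as `𝔽₂`-subspaces of `V ⊕ V` (crux `HeegnerTwistCouplingInSupply`, stmt-BirchSwinnertonDyer-21381, corner layer,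
# EVEN bases `E_{2·P₀⋯P_k}`)

Cell `pub/bsd-wall`, width-prover seat `bsd-wall-cm-bed-w3` g23 (explicit-unit). The even twin of the reviewed `…SymbolicMonskyKernelDefs`
(`virtualKernel`, `augKernel`). For a symbol datum `d : SymbData b` (`N(i,j) = [(P_j/P_i) = −1]`, `m_i = [P_i ≡ 3 (4)]`, `d_i = [(2/P_i) = −1]`,
`(Lx)_i = Σ_j N(i,j)(x_j + x_i)`, `⟨m,x⟩ = Σ_j m_j x_j`):
* `SymbData.evenVirtualKernel d` — the pairs `(u, v)` with `Lu + m⟨m,u⟩ + D_d u + D_m v = 0` and `D_d u + Lv + D_m v + D_d v + ⟨m,u⟩m = 0`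
  coordinatewise: the base block of the kernel of Monsky's EVEN matrix of `2·n₀·ℓ*` (memo THEOREM-A-w3g22 §6b's `𝒦_ev` in the coordinates of the
  kernel-checked identities `…SymbolicMonskyEvenDesignRows.even_design_identities`; by the duality of `…EvenDesignCore` these are also the even
  LEFT pairs `(λ, μ) = (v, u)`);
* `SymbData.evenTwist d δ` — the linear map `(u, v) ↦ (v + ⟨m,u⟩(1+δ), u)` of `V ⊕ V`;
* `SymbData.evenPencil d δ := (evenVirtualKernel.map (evenTwist δ)) ⊔ span {(δ, 1+δ)}` — the EVEN PENCIL `W_ev(δ)` whose transversality to `Z ⊕ Z`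
  is the even one-stage design criterion (`…SymbolicMonskyEvenDesignExists.exists_patternFree_even_design` takes any `W` with this membership).

DEFINITIONS ONLY (three `def`s with the closure / linearity proofs they need); no theorem, no named fact, no `sorry`, no instance, no notation.
Nothing here asserts anything about Selmer groups, `L`-values, the crux or BSD.
Reference: [HeathBrown1994] D. R. Heath-Brown, Invent. Math. 118 (1994) 331–370, appendix by P. Monsky (typescript p. 41 L20–L36).
-/

namespace Summit.BirchSwinnertonDyer.BirchSwinnertonDyer.Theorems.SymbolicMonsky

namespace SymbData

variable {b : ℕ} (d : SymbData b)

/-- The EVEN VIRTUAL KERNEL of a symbol datum: pairs `(u, v)` of `𝔽₂`-vectors with, for every index `i`,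
`Σ_j bz(neg i j)(u_j + u_i) + bz[P_i ≡ 3 (4)]·(Σ_j bz[P_j ≡ 3 (4)] u_j) + bz[(2/P_i) = −1] u_i + bz[P_i ≡ 3 (4)] v_i = 0` and
`bz[(2/P_i) = −1] u_i + Σ_j bz(neg i j)(v_j + v_i) + bz[P_i ≡ 3 (4)] v_i + bz[(2/P_i) = −1] v_i + bz[P_i ≡ 3 (4)]·(Σ_j bz[P_j ≡ 3 (4)] u_j) = 0`,
as a subspace of `V × V`, `V = Fin b → ZMod 2`. [folklore] -/
def evenVirtualKernel : Submodule (ZMod 2) ((Fin b → ZMod 2) × (Fin b → ZMod 2)) where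
  carrier := {p |
    (∀ i, (∑ j, bz (d.neg i j) * (p.1 j + p.1 i)) + bz (negNegOne (d.cls i)) * (∑ j, bz (negNegOne (d.cls j)) * p.1 j) +
      bz (negTwo (d.cls i)) * p.1 i + bz (negNegOne (d.cls i)) * p.2 i = 0) ∧
    (∀ i, bz (negTwo (d.cls i)) * p.1 i + (∑ j, bz (d.neg i j) * (p.2 j + p.2 i)) + bz (negNegOne (d.cls i)) * p.2 i +
      bz (negTwo (d.cls i)) * p.2 i + bz (negNegOne (d.cls i)) * (∑ j, bz (negNegOne (d.cls j)) * p.1 j) = 0)}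
  add_mem' := by
    intro p q hp hq
    have eL : ∀ (x y : Fin b → ZMod 2) (i : Fin b), (∑ j, bz (d.neg i j) * ((x j + y j) + (x i + y i))) =
        (∑ j, bz (d.neg i j) * (x j + x i)) + ∑ j, bz (d.neg i j) * (y j + y i) := fun x y i => by
      rw [← Finset.sum_add_distrib]; exact Finset.sum_congr rfl fun j _ => by ring
    have eM : ∀ (x y : Fin b → ZMod 2), (∑ j, bz (negNegOne (d.cls j)) * (x j + y j)) =
        (∑ j, bz (negNegOne (d.cls j)) * x j) + ∑ j, bz (negNegOne (d.cls j)) * y j := fun x y => by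
      rw [← Finset.sum_add_distrib]; exact Finset.sum_congr rfl fun j _ => by ring
    refine ⟨fun i => ?_, fun i => ?_⟩
    · have h1 := hp.1 i
      have h2 := hq.1 i
      simp only [Prod.fst_add, Prod.snd_add, Pi.add_apply]
      rw [eL, eM]
      linear_combination h1 + h2
    · have h1 := hp.2 i
      have h2 := hq.2 i
      simp only [Prod.fst_add, Prod.snd_add, Pi.add_apply]
      rw [eL, eM]
      linear_combination h1 + h2
  zero_mem' := by
    refine ⟨fun i => ?_, fun i => ?_⟩ <;> simp
  smul_mem' := by
    intro c p hp
    have eL : ∀ (x : Fin b → ZMod 2) (i : Fin b), (∑ j, bz (d.neg i j) * (c * x j + c * x i)) = c * ∑ j, bz (d.neg i j) * (x j + x i) :=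
      fun x i => by rw [Finset.mul_sum]; exact Finset.sum_congr rfl fun j _ => by ring
    have eM : ∀ (x : Fin b → ZMod 2), (∑ j, bz (negNegOne (d.cls j)) * (c * x j)) = c * ∑ j, bz (negNegOne (d.cls j)) * x j :=
      fun x => by rw [Finset.mul_sum]; exact Finset.sum_congr rfl fun j _ => by ring
    refine ⟨fun i => ?_, fun i => ?_⟩
    · have h1 := hp.1 i
      simp only [Prod.smul_fst, Prod.smul_snd, Pi.smul_apply, smul_eq_mul]
      rw [eL, eM]
      linear_combination c * h1
    · have h2 := hp.2 i
      simp only [Prod.smul_fst, Prod.smul_snd, Pi.smul_apply, smul_eq_mul]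
      rw [eL, eM]
      linear_combination c * h2

/-- The EVEN TWIST `(u, v) ↦ (v + ⟨m,u⟩(1 + δ), u)` of `V × V` (a linear map; `⟨m,u⟩ = Σ_j bz[P_j ≡ 3 (4)] u_j`). [folklore] -/
def evenTwist (δ : Fin b → ZMod 2) : ((Fin b → ZMod 2) × (Fin b → ZMod 2)) →ₗ[ZMod 2] ((Fin b → ZMod 2) × (Fin b → ZMod 2)) where
  toFun p := (fun i => p.2 i + (∑ j, bz (negNegOne (d.cls j)) * p.1 j) * (1 + δ i), p.1)
  map_add' := by
    intro p q
    have eM : (∑ j, bz (negNegOne (d.cls j)) * (p.1 j + q.1 j)) =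
        (∑ j, bz (negNegOne (d.cls j)) * p.1 j) + ∑ j, bz (negNegOne (d.cls j)) * q.1 j := by
      rw [← Finset.sum_add_distrib]; exact Finset.sum_congr rfl fun j _ => by ring
    refine Prod.ext ?_ rfl
    funext i
    simp only [Prod.fst_add, Prod.snd_add, Pi.add_apply]
    rw [eM]
    ring
  map_smul' := by
    intro c p
    have eM : (∑ j, bz (negNegOne (d.cls j)) * (c * p.1 j)) = c * ∑ j, bz (negNegOne (d.cls j)) * p.1 j := by
      rw [Finset.mul_sum]; exact Finset.sum_congr rfl fun j _ => by ring
    refine Prod.ext ?_ rfl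
    funext i
    simp only [Prod.smul_fst, Prod.smul_snd, Pi.smul_apply, smul_eq_mul, RingHom.id_apply]
    rw [eM]
    ring

/-- The EVEN PENCIL `W_ev(δ) = T_δ(𝒦_ev) + ⟨(δ, 1 + δ)⟩` of a design with `(2/·)`-vector `δ`. [folklore] -/
def evenPencil (δ : Fin b → ZMod 2) : Submodule (ZMod 2) ((Fin b → ZMod 2) × (Fin b → ZMod 2)) :=
  (d.evenVirtualKernel.map (d.evenTwist δ)) ⊔ Submodule.span (ZMod 2) {(δ, fun i => 1 + δ i)}

end SymbData

end Summit.BirchSwinnertonDyer.BirchSwinnertonDyer.Theorems.SymbolicMonsky
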